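import Literature.AlgebraicGeometry.ModuliOfAbelianVarieties.SiegelCMStructureFreeRankOneAdelic
import Literature.NumberTheory.Adeles.FiniteAdeleLatticeOfGL
import Literature.NumberTheory.NumberFields.IdeleActionOnIdealQuotients
import HarnessLib

/-!
# The reciprocity element acts on lattices as the reflex-norm idèle: `Λ_{R(t)·a} = t · Λ_a` read in `F = ∏ᵢ Kᵢ`
# ([Deligne 1971] 3.9 / 4.18–4.19; [Milne 2005] Def. 12.8 (60)–(62), Thm. 11.2; [Shimura 1998] §18.3 `t𝔞`)

Topic `AlgebraicGeometry/ModuliOfAbelianVarieties`; namespace `Literature.AlgebraicGeometry.ModuliOfAbelianVarieties.CMStructure`.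
Cell hodgecm-mathlib (D-0151), #60 road (row I-7 `SiegelS1`), leaf R60-35 (lead A-p05; MUMFORD-LINE-SPEC §3 step 5
«`N_Φ(s)⁻¹ L_a` vs `r(s)·a`»).  THEOREMS ONLY: no definition, no named fact, no instance, no `sorry` (net Literature debt 0).
A banked GENERIC leaf (director s86 (2)(b)); HC_CM is proved only modulo the printed citations until rung 0 closes.

## Setting and what is proved

`c : CMStructure g δ ι K` (★ (σ4)-D), `v ∈ ℚ^{2g}` a vector (for the dictionary below one takes a CYCLIC vector, ★ R60-14
`exists_bijective_act`, so that `x ↦ act(x)·v : F ≅ ℚ^{2g}` and ★ R60-14b `t ↦ R(t)·(v ⊗ 1) : ∏ᵢ 𝔸_{Kᵢ,f} ≅ 𝔸_{ℚ,f}^{2g}`),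
`a ∈ GL_{2g}(𝔸_{ℚ,f})` (a point `[J, a]` of the Siegel Shimura set), and `r ∈ GL_{2g}(𝔸_{ℚ,f})` with matrix
`R(t) = c.cmRepMatrix t` for a tuple of finite IDÈLES `t = (tᵢ) ∈ ∏ᵢ 𝔸_{Kᵢ,f}^×` — in the reciprocity law ★ `IsCanonical`,
`(r : matrix) = c.cmRecipMatrix Φ E s = R((N_{E,Φᵢ}(s))ᵢ)`.  The lattice of `a` is ★ R60-19 `latticeOfGL a = Λ_a = ℚ^{2g} ∩ a·ẑ^{2g}`
([Milne2005ShimuraVarieties] §4 Prop. 4.18–4.19 pp. 48–49, §6 p. 75).  Suppose the lattice of `a`, read in `F` through `v`, is the product of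
fractional ideals `∏ᵢ 𝔞ᵢ` ADELICALLY: `a⁻¹·R(u)·(v ⊗ 1) ∈ ẑ^{2g} ↔ uᵢ ∈ 𝔞̂ᵢ` for all `u ∈ ∏ᵢ 𝔸_{Kᵢ,f}` (★ `IdeleAction.idealAdeles`, the
adelic closure `∏_𝔭 𝔞_𝔭`; hypothesis `ha`).  Then:

* §1 `cmRepMatrix_algebraMap_mulVec_algebraMap` — `R(x ⊗ 1)·(v ⊗ 1) = (act(x)·v) ⊗ 1` for `x ∈ F` (★ R60-1 `cmRepMatrix_eq_algHom`);
  `coe_inv_eq_cmRepMatrix_inv` — `r⁻¹` has matrix `R(t⁻¹)` (★ `cmRepMatrix_mul`, `cmRepMatrix_one`).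
* §2 **`forall_mulVec_inv_mul_mem_iff`** (adelic form) — `(r·a)⁻¹·R(u)·(v ⊗ 1) ∈ ẑ^{2g} ↔ uᵢ ∈ (tᵢ𝔞ᵢ)^` for every `u`: the adelic
  lattice of `r·a` is `∏ᵢ (tᵢ𝔞ᵢ)^` (★ `cmRepMatrix_mul_mulVec`, ★ `IdeleAction.mul_mem_idealAdeles_iff`).
* §3 **`act_mem_latticeOfGL_mul_iff`** (rational form) — `act(x)·v ∈ Λ_{r·a} ↔ xᵢ ∈ tᵢ𝔞ᵢ` for every `x ∈ F` (★ `IdeleAction.ideleMulIdeal`,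
  Shimura's `t𝔞`; ★ `algebraMap_mem_idealAdeles_iff` «`K ∩ 𝔞̂ = 𝔞`»), and `act_mem_latticeOfGL_iff` — `act(x)·v ∈ Λ_a ↔ xᵢ ∈ 𝔞ᵢ`;
  as `ℤ`-lattices of `F`: `comap_act_latticeOfGL_mul` — `(x ↦ act(x)·v)⁻¹ Λ_{r·a} = ∏ᵢ tᵢ𝔞ᵢ` (`Submodule.pi`).
* §4 **`act_mem_latticeOfGL_mul_iff_of_coe_eq_cmRecipMatrix`** — THE RECIPROCITY ELEMENT `r(s)` (matrix `c.cmRecipMatrix Φ E s`, the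
  binder of ★ `SiegelRationalModel.IsCanonical`) sends the lattice `∏ᵢ 𝔞ᵢ` of `[J, a]` to the lattice `∏ᵢ N_{E,Φᵢ}(s)·𝔞ᵢ` of
  `[J, r(s)·a]` — Milne's normalisation ((60)–(62): `σ[x, a] = [x, r_x(s)·a]`, lattice multiplied by the reflex norm, NO inverse),
  matching ★ R60-22's reading of [Shimura1998] Thm. 18.6 (`ξ′` of type `g(N_{E/K*}(1_∞, t))·𝔞` under `IsArtinCorrespondent`).

NOT here (honest scope): (i) the converse «`Λ_a` read in `F` is `∏ 𝔞ᵢ` RATIONALLY ⇒ the adelic hypothesis `ha`» (density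
`𝔸_{K,f} = K + 𝔞̂` ★ `exists_sub_algebraMap_mem_idealAdeles` + bounded denominators) — a sequel if the M3 assembly wants to start
from the rational description; (ii) lattices that are NOT `∏ 𝓞_{Kᵢ}`-modules (CM by an order; ★ `ideleMulIdeal`'s TODO(general form)),
reached in print through an isogeny ([Deligne1971TravauxShimura] 4.19; MUMFORD-LINE-SPEC §2 (b)).

## References
* [Deligne1971TravauxShimura] P. Deligne, *Travaux de Shimura*, Sém. Bourbaki 389 (1971), 3.9 p. 140, 4.18–4.19 pp. 150–151.
* [Milne2005ShimuraVarieties] J. S. Milne, *Introduction to Shimura varieties* (2005; 2017 revision), §4 Prop. 4.18–4.19 pp. 48–49 and §6 p. 75; Thm. 11.2 p. 108;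
  Def. 12.8 (60)–(62) p. 114.
* [Shimura1998] G. Shimura, *Abelian Varieties with Complex Multiplication and Modular Functions* (1998), §18.3 pp. 122–123 (`t𝔞`), Thm. 18.6 pp. 124–125.
-/

set_option autoImplicit false

noncomputable section

open Module Function NumberField Matrix IsDedekindDomain
open scoped TensorProduct nonZeroDivisors

namespace Literature.AlgebraicGeometry.ModuliOfAbelianVarieties

namespace CMStructure

open Literature.AlgebraicGeometry.Motives (CMType)
open Literature.NumberTheory.ComplexMultiplication
  (traceField ratFiniteAdeleTensorEquiv reflexNormFiniteIdele ratFiniteAdeleTensorEquiv_symm_algebraMap)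
open Literature.NumberTheory.Automorphic (integralFiniteAdeles)
open Literature.NumberTheory.Adeles (latticeOfGL mem_latticeOfGL_iff)
open Literature.NumberTheory.NumberFields.IdeleAction
  (idealAdeles ideleMulIdeal ideleMulIdeal_def ideleMulIdeal_ne_zero mul_mem_idealAdeles_iff algebraMap_mem_idealAdeles_iff)

variable {g : ℕ} {δ : Fin g → ℕ} {ι : Type} [Fintype ι] [DecidableEq ι] {K : ι → Type} [∀ i, Field (K i)]
  [∀ i, NumberField (K i)] [∀ i, IsCMField (K i)] (c : CMStructure g δ ι K)

/-! ### §1. Plumbing: rational elements through `R`, and the inverse of `r` -/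

/-- **`R(x ⊗ 1)·(v ⊗ 1) = (act(x)·v) ⊗ 1`** for `x ∈ F = ∏ Kᵢ` embedded diagonally in `∏ᵢ 𝔸_{Kᵢ,f}`: on rational elements the
adelic representation `R = cmRepMatrix` is `act` (★ `cmRepMatrix_eq_algHom`, ★ `map_actMatrix_mulVec_algebraMap`).
[cite: Deligne1971TravauxShimura, 3.9 p. 140 and 4.18 p. 150] -/
theorem cmRepMatrix_algebraMap_mulVec_algebraMap (x : Π i, K i) (v : Fin g ⊕ Fin g → ℚ) :
    c.cmRepMatrix (fun i => algebraMap (K i) (FiniteAdeleRing (𝓞 (K i)) (K i)) (x i)) *ᵥ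
        (fun j => algebraMap ℚ finAdeleQ (v j)) =
      ⇑(algebraMap ℚ finAdeleQ) ∘ c.act x v := by
  obtain ⟨Θ, hΘ⟩ := c.exists_algHom_extending_actMatrix
  rw [c.cmRepMatrix_eq_algHom Θ hΘ]
  have h : (fun i => (ratFiniteAdeleTensorEquiv (K i)).symm
      (algebraMap (K i) (FiniteAdeleRing (𝓞 (K i)) (K i)) (x i))) = fun i => (1 : finAdeleQ) ⊗ₜ[ℚ] x i := by
    funext i
    rw [ratFiniteAdeleTensorEquiv_symm_algebraMap]
  rw [h, hΘ, one_smul, c.map_actMatrix_mulVec_algebraMap]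
  rfl

/-- **The inverse of `r` has matrix `R(t⁻¹)`** when `r` has matrix `R(t)` for a tuple of finite idèles `t` (`R` is multiplicative
and unital, ★ `cmRepMatrix_mul`, ★ `cmRepMatrix_one`). [cite: Deligne1971TravauxShimura, 3.9 p. 140] -/
theorem coe_inv_eq_cmRepMatrix_inv {r : GL (Fin g ⊕ Fin g) finAdeleQ} {t : Π i, (FiniteAdeleRing (𝓞 (K i)) (K i))ˣ}
    (hr : ((r : GL (Fin g ⊕ Fin g) finAdeleQ) : Matrix (Fin g ⊕ Fin g) (Fin g ⊕ Fin g) finAdeleQ) =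
      c.cmRepMatrix fun i => (t i : FiniteAdeleRing (𝓞 (K i)) (K i))) :
    ((r⁻¹ : GL (Fin g ⊕ Fin g) finAdeleQ) : Matrix (Fin g ⊕ Fin g) (Fin g ⊕ Fin g) finAdeleQ) =
      c.cmRepMatrix fun i => (((t i)⁻¹ : (FiniteAdeleRing (𝓞 (K i)) (K i))ˣ) : FiniteAdeleRing (𝓞 (K i)) (K i)) := by
  refine Units.inv_eq_of_mul_eq_one_left ?_
  rw [hr, ← c.cmRepMatrix_mul]
  have h1 : ((fun i => (((t i)⁻¹ : (FiniteAdeleRing (𝓞 (K i)) (K i))ˣ) : FiniteAdeleRing (𝓞 (K i)) (K i))) *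
      fun i => (t i : FiniteAdeleRing (𝓞 (K i)) (K i))) = 1 := by
    funext i
    rw [Pi.mul_apply, Units.inv_mul, Pi.one_apply]
  rw [h1, c.cmRepMatrix_one]

/-! ### §2. Adelic form: the adelic lattice of `r·a` is `∏ᵢ (tᵢ𝔞ᵢ)^` -/

/-- **`Λ̂_{R(t)·a} = t·Λ̂_a` read in `∏ᵢ 𝔸_{Kᵢ,f}`**: if `r` has matrix `R(t)` (`t = (tᵢ)` finite idèles) and the adelic lattice
`a·ẑ^{2g}` pulled back along the orbit map `u ↦ R(u)·(v ⊗ 1)` is `∏ᵢ 𝔞̂ᵢ` (hypothesis `ha`), then the adelic lattice of `r·a`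
pulled back the same way is `∏ᵢ (tᵢ𝔞ᵢ)^`: `(r·a)⁻¹ R(u) (v ⊗ 1) = a⁻¹ R(t⁻¹u) (v ⊗ 1)` (★ `cmRepMatrix_mul_mulVec`) and
`t⁻¹u ∈ 𝔞̂ ↔ u ∈ (t𝔞)^` (★ `IdeleAction.mul_mem_idealAdeles_iff`, Shimura's `(t𝔞)_𝔭 = t_𝔭𝔞_𝔭`).
[cite: Shimura1998, §18.3 pp. 122–123] [cite: Milne2005ShimuraVarieties, Def. 12.8 (60)–(62) p. 114] [cite: Deligne1971TravauxShimura, 3.9 p. 140] -/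
theorem forall_mulVec_inv_mul_mem_iff {v : Fin g ⊕ Fin g → ℚ} {a r : GL (Fin g ⊕ Fin g) finAdeleQ}
    {t : Π i, (FiniteAdeleRing (𝓞 (K i)) (K i))ˣ}
    (hr : ((r : GL (Fin g ⊕ Fin g) finAdeleQ) : Matrix (Fin g ⊕ Fin g) (Fin g ⊕ Fin g) finAdeleQ) =
      c.cmRepMatrix fun i => (t i : FiniteAdeleRing (𝓞 (K i)) (K i)))
    {𝔞 : Π i, FractionalIdeal (𝓞 (K i))⁰ (K i)} (h𝔞 : ∀ i, 𝔞 i ≠ 0)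
    (ha : ∀ u : Π i, FiniteAdeleRing (𝓞 (K i)) (K i),
      (∀ j, (((a⁻¹ : GL (Fin g ⊕ Fin g) finAdeleQ) : Matrix (Fin g ⊕ Fin g) (Fin g ⊕ Fin g) finAdeleQ) *ᵥ
          (c.cmRepMatrix u *ᵥ fun j => algebraMap ℚ finAdeleQ (v j))) j ∈ integralFiniteAdeles ℚ) ↔
        ∀ i, u i ∈ idealAdeles (𝔞 i))
    (u : Π i, FiniteAdeleRing (𝓞 (K i)) (K i)) :
    (∀ j, ((((r * a)⁻¹ : GL (Fin g ⊕ Fin g) finAdeleQ) : Matrix (Fin g ⊕ Fin g) (Fin g ⊕ Fin g) finAdeleQ) *ᵥ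
          (c.cmRepMatrix u *ᵥ fun j => algebraMap ℚ finAdeleQ (v j))) j ∈ integralFiniteAdeles ℚ) ↔
      ∀ i, u i ∈ idealAdeles (ideleMulIdeal (t i) (𝔞 i)) := by
  set tinv : Π i, FiniteAdeleRing (𝓞 (K i)) (K i) :=
    fun i => (((t i)⁻¹ : (FiniteAdeleRing (𝓞 (K i)) (K i))ˣ) : FiniteAdeleRing (𝓞 (K i)) (K i)) with htinv
  have hvec : (((r * a)⁻¹ : GL (Fin g ⊕ Fin g) finAdeleQ) : Matrix (Fin g ⊕ Fin g) (Fin g ⊕ Fin g) finAdeleQ) *ᵥ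
        (c.cmRepMatrix u *ᵥ fun j => algebraMap ℚ finAdeleQ (v j)) =
      ((a⁻¹ : GL (Fin g ⊕ Fin g) finAdeleQ) : Matrix (Fin g ⊕ Fin g) (Fin g ⊕ Fin g) finAdeleQ) *ᵥ
        (c.cmRepMatrix (tinv * u) *ᵥ fun j => algebraMap ℚ finAdeleQ (v j)) := by
    rw [_root_.mul_inv_rev, Units.val_mul, c.coe_inv_eq_cmRepMatrix_inv hr, ← Matrix.mulVec_mulVec, ← htinv,
      c.cmRepMatrix_mul_mulVec]
  rw [hvec, ha (tinv * u)]
  refine forall_congr' fun i => ?_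
  rw [Pi.mul_apply, htinv]
  have hmem := mul_mem_idealAdeles_iff (t i) (h𝔞 i)
    (a := (((t i)⁻¹ : (FiniteAdeleRing (𝓞 (K i)) (K i))ˣ) : FiniteAdeleRing (𝓞 (K i)) (K i)) * u i)
  rw [← mul_assoc, Units.mul_inv, one_mul, ← ideleMulIdeal_def] at hmem
  exact hmem.symm

/-! ### §3. Rational form: `Λ_{r·a}` read in `F` is `∏ᵢ tᵢ𝔞ᵢ` -/

/-- **The lattice of `[J, a]` read in `F`**: under the adelic hypothesis `ha`, `act(x)·v ∈ Λ_a = ℚ^{2g} ∩ a·ẑ^{2g}` (★ R60-19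
`latticeOfGL`) iff `xᵢ ∈ 𝔞ᵢ` for every `i` («`K ∩ 𝔞̂ = 𝔞`», ★ `algebraMap_mem_idealAdeles_iff`).
[cite: Milne2005ShimuraVarieties, §4 Prop. 4.18–4.19 pp. 48–49 and §6 p. 75] [cite: Shimura1998, §18.3 p. 122] -/
theorem act_mem_latticeOfGL_iff {v : Fin g ⊕ Fin g → ℚ} {a : GL (Fin g ⊕ Fin g) finAdeleQ}
    {𝔞 : Π i, FractionalIdeal (𝓞 (K i))⁰ (K i)} (h𝔞 : ∀ i, 𝔞 i ≠ 0)
    (ha : ∀ u : Π i, FiniteAdeleRing (𝓞 (K i)) (K i),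
      (∀ j, (((a⁻¹ : GL (Fin g ⊕ Fin g) finAdeleQ) : Matrix (Fin g ⊕ Fin g) (Fin g ⊕ Fin g) finAdeleQ) *ᵥ
          (c.cmRepMatrix u *ᵥ fun j => algebraMap ℚ finAdeleQ (v j))) j ∈ integralFiniteAdeles ℚ) ↔
        ∀ i, u i ∈ idealAdeles (𝔞 i))
    (x : Π i, K i) :
    c.act x v ∈ latticeOfGL a ↔ ∀ i, x i ∈ 𝔞 i := by
  rw [mem_latticeOfGL_iff, ← c.cmRepMatrix_algebraMap_mulVec_algebraMap x v, ha]
  exact forall_congr' fun i => algebraMap_mem_idealAdeles_iff (h𝔞 i)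

/-- **THE LATTICE OF `[J, r·a]` IS `t · (∏ 𝔞ᵢ)`**: under `(r : matrix) = R(t)` and the adelic hypothesis `ha` on `a`,
`act(x)·v ∈ Λ_{r·a} ↔ xᵢ ∈ tᵢ𝔞ᵢ` for every `x ∈ F` (★ `IdeleAction.ideleMulIdeal`, Shimura's `t𝔞` with `(t𝔞)_𝔭 = t_𝔭𝔞_𝔭`) —
MUMFORD-LINE-SPEC §3 step 5: the reciprocity element moves the lattice by the idèle `t`, FACTORWISE.
[cite: Shimura1998, §18.3 pp. 122–123]
[cite: Milne2005ShimuraVarieties, Def. 12.8 (60)–(62) p. 114; §4 Prop. 4.18–4.19 pp. 48–49 and §6 p. 75]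
[cite: Deligne1971TravauxShimura, 3.9 p. 140, 4.18–4.19 pp. 150–151] -/
theorem act_mem_latticeOfGL_mul_iff {v : Fin g ⊕ Fin g → ℚ} {a r : GL (Fin g ⊕ Fin g) finAdeleQ}
    {t : Π i, (FiniteAdeleRing (𝓞 (K i)) (K i))ˣ}
    (hr : ((r : GL (Fin g ⊕ Fin g) finAdeleQ) : Matrix (Fin g ⊕ Fin g) (Fin g ⊕ Fin g) finAdeleQ) =
      c.cmRepMatrix fun i => (t i : FiniteAdeleRing (𝓞 (K i)) (K i)))
    {𝔞 : Π i, FractionalIdeal (𝓞 (K i))⁰ (K i)} (h𝔞 : ∀ i, 𝔞 i ≠ 0)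
    (ha : ∀ u : Π i, FiniteAdeleRing (𝓞 (K i)) (K i),
      (∀ j, (((a⁻¹ : GL (Fin g ⊕ Fin g) finAdeleQ) : Matrix (Fin g ⊕ Fin g) (Fin g ⊕ Fin g) finAdeleQ) *ᵥ
          (c.cmRepMatrix u *ᵥ fun j => algebraMap ℚ finAdeleQ (v j))) j ∈ integralFiniteAdeles ℚ) ↔
        ∀ i, u i ∈ idealAdeles (𝔞 i))
    (x : Π i, K i) :
    c.act x v ∈ latticeOfGL (r * a) ↔ ∀ i, x i ∈ ideleMulIdeal (t i) (𝔞 i) := by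
  rw [mem_latticeOfGL_iff, ← c.cmRepMatrix_algebraMap_mulVec_algebraMap x v, c.forall_mulVec_inv_mul_mem_iff hr h𝔞 ha]
  exact forall_congr' fun i => algebraMap_mem_idealAdeles_iff (ideleMulIdeal_ne_zero (t i) (h𝔞 i))

/-- **As `ℤ`-lattices of `F = ∏ᵢ Kᵢ`**: the pull-back of `Λ_{r·a}` along `x ↦ act(x)·v` is the product `∏ᵢ tᵢ𝔞ᵢ` (a `ℤ`-submodule
of `∏ᵢ Kᵢ` through `Submodule.pi`), under the same hypotheses.
[cite: Shimura1998, §18.3 pp. 122–123]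
[cite: Milne2005ShimuraVarieties, Def. 12.8 (60)–(62) p. 114; §4 Prop. 4.18–4.19 pp. 48–49 and §6 p. 75] -/
theorem comap_act_latticeOfGL_mul {v : Fin g ⊕ Fin g → ℚ} {a r : GL (Fin g ⊕ Fin g) finAdeleQ}
    {t : Π i, (FiniteAdeleRing (𝓞 (K i)) (K i))ˣ}
    (hr : ((r : GL (Fin g ⊕ Fin g) finAdeleQ) : Matrix (Fin g ⊕ Fin g) (Fin g ⊕ Fin g) finAdeleQ) =
      c.cmRepMatrix fun i => (t i : FiniteAdeleRing (𝓞 (K i)) (K i)))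
    {𝔞 : Π i, FractionalIdeal (𝓞 (K i))⁰ (K i)} (h𝔞 : ∀ i, 𝔞 i ≠ 0)
    (ha : ∀ u : Π i, FiniteAdeleRing (𝓞 (K i)) (K i),
      (∀ j, (((a⁻¹ : GL (Fin g ⊕ Fin g) finAdeleQ) : Matrix (Fin g ⊕ Fin g) (Fin g ⊕ Fin g) finAdeleQ) *ᵥ
          (c.cmRepMatrix u *ᵥ fun j => algebraMap ℚ finAdeleQ (v j))) j ∈ integralFiniteAdeles ℚ) ↔
        ∀ i, u i ∈ idealAdeles (𝔞 i)) :
    (latticeOfGL (r * a)).comap (((LinearMap.applyₗ v).comp c.act.toLinearMap).restrictScalars ℤ) =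
      Submodule.pi Set.univ fun i =>
        (((ideleMulIdeal (t i) (𝔞 i) : FractionalIdeal (𝓞 (K i))⁰ (K i)) : Submodule (𝓞 (K i)) (K i)).restrictScalars ℤ) := by
  ext x
  rw [Submodule.mem_comap, Submodule.mem_pi]
  change c.act x v ∈ latticeOfGL (r * a) ↔ _
  rw [c.act_mem_latticeOfGL_mul_iff hr h𝔞 ha]
  simp only [Set.mem_univ, forall_const, Submodule.restrictScalars_mem, FractionalIdeal.mem_coe]

/-! ### §4. The reciprocity element `r(s)` of ★ `IsCanonical`: lattice `∏ 𝔞ᵢ ↦ ∏ N_{E,Φᵢ}(s)·𝔞ᵢ` -/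

/-- **THE RECIPROCITY ELEMENT ACTS ON LATTICES AS THE REFLEX-NORM IDÈLE (Milne's normalisation).**  For a CM structure `c`, CM types
`Φ`, a number field `E ⊆ ℂ`, a finite idèle `s` of `E`, and `r ∈ GL_{2g}(𝔸_{ℚ,f})` with matrix the reciprocity element
`c.cmRecipMatrix Φ E s = R((N_{E,Φᵢ}(s))ᵢ)` (the binder of ★ `SiegelRationalModel.IsCanonical`): if the lattice of `[J, a]` read in
`F` through `v` is `∏ᵢ 𝔞ᵢ` (adelically, `ha`), then the lattice of `[J, r·a]` read the same way is `∏ᵢ N_{E,Φᵢ}(s)·𝔞ᵢ`: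
`act(x)·v ∈ Λ_{r·a} ↔ xᵢ ∈ N_{E,Φᵢ}(s)·𝔞ᵢ` for all `x ∈ F` — «`σ[x, a] = [x, r_x(s)·a]`» moves the lattice by the reflex norm
(NO inverse: [Milne2005ShimuraVarieties] Thm. 11.2 «`α(N_Φ(s)·x) = σx`»; ★ R60-22 reads [Shimura1998] Thm. 18.6 with `art = rec⁻¹` as
`ξ′` of type `g(N_{E/K*}(1_∞, t))·𝔞`).
[cite: Milne2005ShimuraVarieties, Thm. 11.2 p. 108; Def. 12.8 (60)–(62) p. 114] [cite: Deligne1971TravauxShimura, 4.18–4.19 pp. 150–151]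
[cite: Shimura1998, §18.3 pp. 122–123; Thm. 18.6 pp. 124–125] -/
theorem act_mem_latticeOfGL_mul_iff_of_coe_eq_cmRecipMatrix {v : Fin g ⊕ Fin g → ℚ} {a r : GL (Fin g ⊕ Fin g) finAdeleQ}
    (Φ : ∀ i, CMType (K i)) (E : IntermediateField ℚ ℂ) [NumberField ↥E] (s : (FiniteAdeleRing (𝓞 ↥E) ↥E)ˣ)
    (hr : ((r : GL (Fin g ⊕ Fin g) finAdeleQ) : Matrix (Fin g ⊕ Fin g) (Fin g ⊕ Fin g) finAdeleQ) = c.cmRecipMatrix Φ E s)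
    {𝔞 : Π i, FractionalIdeal (𝓞 (K i))⁰ (K i)} (h𝔞 : ∀ i, 𝔞 i ≠ 0)
    (ha : ∀ u : Π i, FiniteAdeleRing (𝓞 (K i)) (K i),
      (∀ j, (((a⁻¹ : GL (Fin g ⊕ Fin g) finAdeleQ) : Matrix (Fin g ⊕ Fin g) (Fin g ⊕ Fin g) finAdeleQ) *ᵥ
          (c.cmRepMatrix u *ᵥ fun j => algebraMap ℚ finAdeleQ (v j))) j ∈ integralFiniteAdeles ℚ) ↔
        ∀ i, u i ∈ idealAdeles (𝔞 i))
    (x : Π i, K i) :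
    c.act x v ∈ latticeOfGL (r * a) ↔ ∀ i, x i ∈ ideleMulIdeal (reflexNormFiniteIdele (K i) (Φ i) E s) (𝔞 i) :=
  c.act_mem_latticeOfGL_mul_iff (t := fun i => reflexNormFiniteIdele (K i) (Φ i) E s) hr h𝔞 ha x

/-- The same at the level of the adelic lattices: `(r(s)·a)⁻¹ R(u) (v ⊗ 1) ∈ ẑ^{2g} ↔ uᵢ ∈ (N_{E,Φᵢ}(s)·𝔞ᵢ)^` — the form in which
the torsion/adelic-points comparison of the main theorem (★ `IdeleAction.ideleMulEquiv`, ★ R60-28) is read.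
[cite: Milne2005ShimuraVarieties, Thm. 11.2 p. 108; Def. 12.8 (60)–(62) p. 114] [cite: Shimura1998, §18.3 pp. 122–123] -/
theorem forall_mulVec_inv_mul_mem_iff_of_coe_eq_cmRecipMatrix {v : Fin g ⊕ Fin g → ℚ} {a r : GL (Fin g ⊕ Fin g) finAdeleQ}
    (Φ : ∀ i, CMType (K i)) (E : IntermediateField ℚ ℂ) [NumberField ↥E] (s : (FiniteAdeleRing (𝓞 ↥E) ↥E)ˣ)
    (hr : ((r : GL (Fin g ⊕ Fin g) finAdeleQ) : Matrix (Fin g ⊕ Fin g) (Fin g ⊕ Fin g) finAdeleQ) = c.cmRecipMatrix Φ E s)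
    {𝔞 : Π i, FractionalIdeal (𝓞 (K i))⁰ (K i)} (h𝔞 : ∀ i, 𝔞 i ≠ 0)
    (ha : ∀ u : Π i, FiniteAdeleRing (𝓞 (K i)) (K i),
      (∀ j, (((a⁻¹ : GL (Fin g ⊕ Fin g) finAdeleQ) : Matrix (Fin g ⊕ Fin g) (Fin g ⊕ Fin g) finAdeleQ) *ᵥ
          (c.cmRepMatrix u *ᵥ fun j => algebraMap ℚ finAdeleQ (v j))) j ∈ integralFiniteAdeles ℚ) ↔
        ∀ i, u i ∈ idealAdeles (𝔞 i))
    (u : Π i, FiniteAdeleRing (𝓞 (K i)) (K i)) :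
    (∀ j, ((((r * a)⁻¹ : GL (Fin g ⊕ Fin g) finAdeleQ) : Matrix (Fin g ⊕ Fin g) (Fin g ⊕ Fin g) finAdeleQ) *ᵥ
          (c.cmRepMatrix u *ᵥ fun j => algebraMap ℚ finAdeleQ (v j))) j ∈ integralFiniteAdeles ℚ) ↔
      ∀ i, u i ∈ idealAdeles (ideleMulIdeal (reflexNormFiniteIdele (K i) (Φ i) E s) (𝔞 i)) :=
  c.forall_mulVec_inv_mul_mem_iff (t := fun i => reflexNormFiniteIdele (K i) (Φ i) E s) hr h𝔞 ha u

end CMStructure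

end Literature.AlgebraicGeometry.ModuliOfAbelianVarieties

end
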